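import Summits.CriticalPhenomena.PercolationContinuityZ3.Theses.PercSubharmonicSquare

/-!
# Birth skeleton (BC3) for the piece `DefectSubMeanValue` — child 1 of the deciding crux
# `SubharmonicPower` (stmt-CriticalPhenomena-11505), route `PercSubharmonicSquare`

Piece (route child, strategist split 2026-08-17):
`DefectSubMeanValue := ∃ A ≥ 0, R, ∀ p < p_c(ℤ³), ∀ ‖x‖ > R, τ_p(0,x) ≤ (1 + A/‖x‖²) · m_p(x)`,
`m_p(x) = (1/6) Σ_i [τ_p(0,x+e_i) + τ_p(0,x-e_i)]` — the `s = 1` sub-mean-value property of the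
subcritical connectivity up to a relative `O(‖x‖⁻²)` defect, uniformly in `p`.

## The cut: massive regime / critical window, by the `p`-uniform local indicator `τ_p(0,x)·‖x‖`

For `p < p_c` the connectivity decays exponentially at rate `1/ξ(p)`; the sites with
`τ_p(0,x)·‖x‖ ≤ δ` are (up to a logarithm) those with `‖x‖ ≳ ξ(p) log(1/δ)` — the MASSIVE
(Ornstein–Zernike) regime — while `τ_p(0,x)·‖x‖ > δ` is the CRITICAL WINDOW `‖x‖ ≲ ξ(p)·polylog`
(at `p_c` itself, `τ·r ≍ r^{-η}` with `η(3) ≈ -0.046 < 0`, so the window is everything). The indicator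
is a function of the data of the statement only (no correlation length needs to be defined), and the
two halves are different theorems:

* `stub_massiveDefect` — `∃ δ > 0, A, R`: in the massive regime the defect is `≤ A/r²` (expected: `0`;
  the OZ profile `Ψ(x̂) e^{-r/ξ}/r` has continuum Laplacian `+u/ξ² > 0`). A uniform-in-`p`
  Ornstein–Zernike statement with control of SECOND differences: Campanino–Ioffe–Velenik 2008 give
  the asymptotics for every fixed `p < p_c` (analytic local limit structure), not uniformly as
  `ξ(p) → ∞`, and not for differences.
* `stub_windowDefect` — `∀ δ > 0, ∃ A, R`: in the critical window the defect is `≤ A/r²`. This is the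
  `η`-type regularity statement (`-Δτ ≤ (6A/r²) m`; for `r^{-a}`, `a = 1+η`, the defect is
  `a(1-a)/(6r²)`), i.e. `(log g)'' ≥ -C/y²` for the crossover scaling function plus `r⁻²` control of
  corrections to scaling. `∀ δ` does not make it the piece: `A = A(δ)` may blow up as `δ → 0`.

Composition `DefectSubMeanValue_of`: take `δ` from stub 1, instantiate stub 2 at that `δ`, case on
`τ_p(0,x)·‖x‖ ≤ δ`, with `A := max A₁ A₂`, `R := max R₁ R₂` (monotonicity of the bound in `A` uses
`m_p(x) ≥ 0`). Real proof, no `sorry` outside the stubs.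

Disproof used: none exists for this crux (`ledger crux ls stmt-CriticalPhenomena-11505`: no
Disproof.lean); negatives index of the summit: no statement about connectivity (sub)harmonicity.
-/

namespace Summit.CriticalPhenomena.PercolationContinuityZ3.Cruxes.SubharmonicPower.DefectSubMeanValueBirth

open Literature.Probability.Percolation Literature.Probability.LatticeModels

/-- The piece, by value (it becomes the route decl `PercSubharmonicSquare.DefectSubMeanValue` when the
split is applied; until then it is written out). -/
def DefectSubMeanValue : Prop :=
  ∃ (A : ℝ) (R : ℕ), 0 ≤ A ∧ ∀ p : unitInterval, (p : ℝ) < Literature.Probability.Percolation.criticalProb (Literature.Probability.LatticeModels.zdGraph 3) (0 : Literature.Probability.LatticeModels.Site 3) → ∀ x : Literature.Probability.LatticeModels.Site 3, (R : ℝ) < ‖x‖ → Literature.Probability.Percolation.tau 3 p 0 x ≤ (1 + A / ‖x‖ ^ 2) * ((1 / 6 : ℝ) * ∑ i : Fin 3, (Literature.Probability.Percolation.tau 3 p 0 (x + Pi.single i 1) + Literature.Probability.Percolation.tau 3 p 0 (x - Pi.single i 1)))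

/-- **Stub 1 (massive / Ornstein–Zernike regime).** There are `δ > 0`, `A ≥ 0`, `R` such that for every
`p < p_c(ℤ³)` and every `‖x‖ > R` with `τ_p(0,x)·‖x‖ ≤ δ` (i.e. `‖x‖ ≳ ξ(p) log(1/δ)`),
`τ_p(0,x) ≤ (1 + A/‖x‖²) m_p(x)`. Why plausibly true: the OZ profile `e^{-r/ξ}/r` is strictly
subharmonic (`Δu = u/ξ²`), uniformly in the direction-dependence of `ξ`; `p ≤ 1/6` is the proved
`SmallDensitySubharmonic` (`A = 0`). Size: L (uniform OZ up to second differences). -/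
theorem stub_massiveDefect :
    ∃ (δ : ℝ) (A : ℝ) (R : ℕ), 0 < δ ∧ 0 ≤ A ∧ ∀ p : unitInterval,
      (p : ℝ) < criticalProb (zdGraph 3) (0 : Site 3) → ∀ x : Site 3, (R : ℝ) < ‖x‖ →
        tau 3 p 0 x * ‖x‖ ≤ δ →
        tau 3 p 0 x ≤ (1 + A / ‖x‖ ^ 2) * ((1 / 6 : ℝ) * ∑ i : Fin 3,
          (tau 3 p 0 (x + Pi.single i 1) + tau 3 p 0 (x - Pi.single i 1))) := by
  sorry

/-- **Stub 2 (critical window).** For every `δ > 0` there are `A ≥ 0`, `R` such that for every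
`p < p_c(ℤ³)` and every `‖x‖ > R` with `τ_p(0,x)·‖x‖ > δ` (i.e. `‖x‖ ≲ ξ(p)·polylog`; at `p_c` every
far site), `τ_p(0,x) ≤ (1 + A/‖x‖²) m_p(x)`. Why plausibly true: for the critical law `r^{-(1+η)}`,
`η < 0`, the defect is `a(1-a)/(6r²)`; world-neutral (plateau approaches have defect `≤ 1/(6r²)`).
The hardest stub: an `r⁻²` one-sided second-difference bound with no known gradient regularity of
`τ_p` in `d = 3`. Size: XL. -/
theorem stub_windowDefect :
    ∀ δ : ℝ, 0 < δ → ∃ (A : ℝ) (R : ℕ), 0 ≤ A ∧ ∀ p : unitInterval,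
      (p : ℝ) < criticalProb (zdGraph 3) (0 : Site 3) → ∀ x : Site 3, (R : ℝ) < ‖x‖ →
        δ < tau 3 p 0 x * ‖x‖ →
        tau 3 p 0 x ≤ (1 + A / ‖x‖ ^ 2) * ((1 / 6 : ℝ) * ∑ i : Fin 3,
          (tau 3 p 0 (x + Pi.single i 1) + tau 3 p 0 (x - Pi.single i 1))) := by
  sorry

/-- **Composition (real proof).** The two regimes exhaust the far sites; the bound is monotone in `A`
because the ring mean is non-negative. [folklore] -/
theorem DefectSubMeanValue_of
    (h1 : ∃ (δ : ℝ) (A : ℝ) (R : ℕ), 0 < δ ∧ 0 ≤ A ∧ ∀ p : unitInterval,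
      (p : ℝ) < criticalProb (zdGraph 3) (0 : Site 3) → ∀ x : Site 3, (R : ℝ) < ‖x‖ →
        tau 3 p 0 x * ‖x‖ ≤ δ →
        tau 3 p 0 x ≤ (1 + A / ‖x‖ ^ 2) * ((1 / 6 : ℝ) * ∑ i : Fin 3,
          (tau 3 p 0 (x + Pi.single i 1) + tau 3 p 0 (x - Pi.single i 1))))
    (h2 : ∀ δ : ℝ, 0 < δ → ∃ (A : ℝ) (R : ℕ), 0 ≤ A ∧ ∀ p : unitInterval,
      (p : ℝ) < criticalProb (zdGraph 3) (0 : Site 3) → ∀ x : Site 3, (R : ℝ) < ‖x‖ →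
        δ < tau 3 p 0 x * ‖x‖ →
        tau 3 p 0 x ≤ (1 + A / ‖x‖ ^ 2) * ((1 / 6 : ℝ) * ∑ i : Fin 3,
          (tau 3 p 0 (x + Pi.single i 1) + tau 3 p 0 (x - Pi.single i 1)))) :
    DefectSubMeanValue := by
  obtain ⟨δ, A₁, R₁, hδ, hA₁, H1⟩ := h1
  obtain ⟨A₂, R₂, hA₂, H2⟩ := h2 δ hδ
  refine ⟨max A₁ A₂, max R₁ R₂, le_max_of_le_left hA₁, ?_⟩
  intro p hp x hx
  push_cast at hx
  obtain ⟨hx1, hx2⟩ := max_lt_iff.mp hx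
  -- the ring mean is non-negative, so the bound is monotone in `A`
  have hm : 0 ≤ (1 / 6 : ℝ) * ∑ i : Fin 3,
      (tau 3 p 0 (x + Pi.single i 1) + tau 3 p 0 (x - Pi.single i 1)) :=
    mul_nonneg (by norm_num)
      (Finset.sum_nonneg fun i _ => add_nonneg (tau_nonneg p 0 _) (tau_nonneg p 0 _))
  have hmono : ∀ A : ℝ, A ≤ max A₁ A₂ →
      (1 + A / ‖x‖ ^ 2) * ((1 / 6 : ℝ) * ∑ i : Fin 3,
        (tau 3 p 0 (x + Pi.single i 1) + tau 3 p 0 (x - Pi.single i 1))) ≤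
      (1 + max A₁ A₂ / ‖x‖ ^ 2) * ((1 / 6 : ℝ) * ∑ i : Fin 3,
        (tau 3 p 0 (x + Pi.single i 1) + tau 3 p 0 (x - Pi.single i 1))) := by
    intro A hA
    apply mul_le_mul_of_nonneg_right _ hm
    have : A / ‖x‖ ^ 2 ≤ max A₁ A₂ / ‖x‖ ^ 2 :=
      div_le_div_of_nonneg_right hA (sq_nonneg _)
    linarith
  rcases le_or_gt (tau 3 p 0 x * ‖x‖) δ with hle | hlt
  · exact (H1 p hp x hx1 hle).trans (hmono A₁ (le_max_left _ _))
  · exact (H2 p hp x hx2 hlt).trans (hmono A₂ (le_max_right _ _))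

end Summit.CriticalPhenomena.PercolationContinuityZ3.Cruxes.SubharmonicPower.DefectSubMeanValueBirth
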